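import Summits.AtomisticToContinuum.BoseEinsteinCondensation.Theses.BECBathMassLiouville
import Summits.AtomisticToContinuum.BoseEinsteinCondensation.Theorems.BECInsertionCorrectorResidueCondenses
import HarnessLib

/-!
# Route `BECBathMassLiouville`, support item `ResidueCondensesAll` (stmt-AtomisticToContinuum-14388)

**A uniformly positive insertion residue (this route's `∀Θ ∀Ψ` target `InsertionResidue`) forces
torus BEC of near-minimisers.** Fix a repulsive finite-range `v`, a density `ρ < ρ₀(v)` and, for
large `N`, the window `δ_N > 0` of `InsertionResidue`. Given a `δ`-near-minimiser `Ψ` of the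
periodic `(N+1)`-body energy on the torus of side `L = ((N+1)/ρ)^{1/3}`, PICK a `δ`-near-minimiser
`Θ` of the periodic `N`-body energy on the same torus (`exists_periodicEnergy_le_groundState_add`:
if `E₀^per(N,L) < ⊤` by the infimum property, `δ > 0`; if `E₀^per(N,L) = ⊤` the constant state
`planeWave N hL 0` will do). The residue gives `c ≤ L⁻³ |∫ conj Θ(X) ∫_cell Ψ(x,X) dx dX|²`, and
Cauchy–Schwarz in `X` against the normalised `Θ` inside
`condensateOccupation (N+1) L Ψ = (N+1) L⁻³ ∫ |∫_cell Ψ(x,X) dx|² dX` (the landed lemma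
`CorrectorClosure.Negative.succ_mul_overlap_sq_le_condensateOccupation`) yields
`condensateOccupation (N+1) L Ψ ≥ c (N+1)`. The `∀ᶠ N` shift `N ↦ N + 1` is bookkeeping
(`Filter.eventually_atTop`); boxes agree (`sideLength ρ (N+1)` on both sides).

* `exists_periodicEnergy_le_groundState_add` — near-minimisers exist at every slack `δ > 0` on a
  torus of positive side (all cases, including `E₀ = ⊤`);
* `ResidueCondensesAll_proof` — the route decl, closing item stmt-AtomisticToContinuum-14388.

References: [PenroseOnsager1956] (criterion), [LSSY2005, §1.2 (1.17)–(1.18)] (occupation),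
[Fournais2020, (1.3)–(1.4)] (`P_{Ω,j}`, `n₀`). The argument is folklore.
-/

noncomputable section

open MeasureTheory Filter
open scoped ENNReal NNReal ComplexConjugate

namespace Summit.AtomisticToContinuum.BoseEinsteinCondensation.Theorems

open Literature.MathematicalPhysics.QuantumManyBody.BoseGas
open Summit.AtomisticToContinuum.BoseEinsteinCondensation.Theorems.CorrectorClosure.Negative

/-- **Near-minimisers exist at every positive slack** on a torus of side `L > 0`: for `δ > 0`
there is a periodic `N`-body trial state `Θ` with `⟨Θ, HΘ⟩ ≤ E₀^per(N,L) + δ` (infimum property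
if `E₀^per < ⊤`; the constant state if `E₀^per = ⊤`, when every state qualifies). [folklore] -/
theorem exists_periodicEnergy_le_groundState_add {N : ℕ} {L : ℝ} (hL : 0 < L) (v : ℝ → ℝ≥0∞)
    {δ : ℝ≥0∞} (hδ : 0 < δ) :
    ∃ Θ : PeriodicTrialState N L, periodicEnergy v Θ ≤ periodicGroundStateEnergy v N L + δ := by
  by_cases hE : periodicGroundStateEnergy v N L = ⊤
  · exact ⟨planeWave N hL 0, by rw [hE, top_add]; exact le_top⟩
  · obtain ⟨Θ, hΘ⟩ := iInf_lt_iff.1 (ENNReal.lt_add_right hE hδ.ne')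
    exact ⟨Θ, hΘ.le⟩

/-- **Item stmt-AtomisticToContinuum-14388** (`ResidueCondensesAll` of route `BECBathMassLiouville`):
for every repulsive finite-range `v`, the insertion residue `InsertionResidue` (a uniformly
positive zero-momentum overlap `L⁻³|⟨Θ, ∫_cell Ψ(x,·) dx⟩|² ≥ c` between EVERY pair of
`δ`-near-minimisers `Θ` (periodic `N`-body) and `Ψ` (periodic `(N+1)`-body) on the torus of side
`((N+1)/ρ)^{1/3}`, `ρ < ρ₀(v)`, `N` large) gives torus BEC of the `(N+1)`-body near-minimisers,
`⟨Ψ, n₀ Ψ⟩ ≥ c (N+1)`, eventually in `N` — the `PeriodicBEC` body read at particle number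
`N + 1`. Proof: pick a near-minimiser `Θ` and apply Cauchy–Schwarz against it. [folklore] -/
theorem ResidueCondensesAll_proof :
    Summit.AtomisticToContinuum.BoseEinsteinCondensation.Theses.BECBathMassLiouville.ResidueCondensesAll := by
  unfold Summit.AtomisticToContinuum.BoseEinsteinCondensation.Theses.BECBathMassLiouville.ResidueCondensesAll
    Summit.AtomisticToContinuum.BoseEinsteinCondensation.Theses.BECBathMassLiouville.InsertionResidue
  intro v hv hIR
  obtain ⟨ρ₀, hρ₀, hρ⟩ := hIR v hv
  refine ⟨ρ₀, hρ₀, fun ρ hρpos hρlt => ?_⟩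
  obtain ⟨c, hc, hN⟩ := hρ ρ hρpos hρlt
  refine ⟨c, hc, ?_⟩
  rw [Filter.eventually_atTop] at hN ⊢
  obtain ⟨N₀, hN₀⟩ := hN
  refine ⟨N₀ + 1, fun M hM => ?_⟩
  -- read the goal at particle number `M = N + 1`
  obtain ⟨N, rfl⟩ : ∃ N, M = N + 1 := ⟨M - 1, by omega⟩
  obtain ⟨δ, hδ, hΘΨ⟩ := hN₀ N (by omega)
  refine ⟨δ, hδ, fun Ψ hΨE => ?_⟩
  have hL : 0 < sideLength ρ (N + 1) := sideLength_succ_pos hρpos N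
  -- pick an `N`-body `δ`-near-minimiser on the same torus
  obtain ⟨Θ, hΘE⟩ := exists_periodicEnergy_le_groundState_add hL v hδ
  calc ENNReal.ofReal (c * ((N + 1 : ℕ) : ℝ))
      = (N + 1 : ℝ≥0∞) * ENNReal.ofReal c := ofReal_mul_natCast_succ hc.le N
    _ ≤ (N + 1 : ℝ≥0∞) * (ENNReal.ofReal ((sideLength ρ (N + 1) ^ 3)⁻¹) *
          (‖∫ X in cellN N (sideLength ρ (N + 1)), conj (Θ.ψ X) *
              ∫ x in cell (sideLength ρ (N + 1)), Ψ.ψ (Matrix.vecCons x X)‖₊ : ℝ≥0∞) ^ 2) := by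
        gcongr
        exact hΘΨ Θ Ψ hΘE hΨE
    _ ≤ condensateOccupation (N + 1) (sideLength ρ (N + 1)) Ψ.ψ :=
        succ_mul_overlap_sq_le_condensateOccupation hL Θ Ψ

end Summit.AtomisticToContinuum.BoseEinsteinCondensation.Theorems

end
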